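import Literature.Geometry.Lorentzian.RiemannianVolumeIsometry
import Literature.Geometry.Lorentzian.DalembertianNaturality
import Literature.Geometry.Lorentzian.IsometryProofs
import Literature.Geometry.Riemannian.L2HarmonicOneFormsSobolev
import HarnessLib

/-!
# Transport of a Riemannian metric, of the Sobolev inequality `(S_p)` and of harmonic functions
# with finite Dirichlet energy along a diffeomorphism (isometry invariance)

Sixth layer (transport, part B) of the proof programme of the named fact
`Literature.Geometry.Riemannian.Carron1998_ends_le_rank_l2HarmonicOneForms`
(`L2HarmonicOneFormsSobolev.lean`). The analytic layers are proved for manifolds charted on a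
boundaryless MODEL (indeed on `EuclideanSpace ℝ (Fin m)`), while the fact is stated for any real
model with corners and a manifold without boundary; the passage is the identity diffeomorphism onto
a recharted copy (`Literature.Geometry.Manifold.ExtRechart.toOrig`). This file PROVES the
diffeomorphism-invariance statements that passage consumes, for an arbitrary `C^∞`
diffeomorphism `Φ : N → M` between manifolds over finite-dimensional real models (O'Neill 1983,
Ch. 3, pp. 58 and 90–91: an isometry preserves every metric quantity):

* `exists_contMDiffRiemannianMetric_isIsometry` — a smooth Mathlib Riemannian metric `h` on `M`
  has a transported metric `hN` on `N` making `Φ` an isometry `(N, hN) → (M, h)` (the pullback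
  `Φ^* h`, `PseudoRiemannianMetric.comap` with `contMDiff_pullbackBilin_holds`);
* `IsIsometry.eq_comap` — conversely an isometry identifies the source metric with the pullback;
* `IsIsometry.innerDual_comp_mfderiv` — the inverse metrics correspond on pulled-back covectors,
  `hN⁻¹(α ∘ dΦ, β ∘ dΦ) = h⁻¹(α, β)`, whence `|d(f ∘ Φ)|²_{hN} = |df|²_h ∘ Φ`
  (`IsIsometry.innerDual_mvfderiv_comp`);
* `IsIsometry.hasSobolevInequality` — **`(S_p)` with constant `μ` transports from `(M, h)` to
  `(N, hN)`** (test `u ∘ Φ⁻¹`, the Riemannian measures corresponding under `Φ`,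
  `IsIsometry.measurePreserving_riemannianMeasure`);
* `IsIsometry.dalembertian_comp` — `Δ_{hN} (f ∘ Φ) = (Δ_h f) ∘ Φ` (`dalembertian_comap`), and
  `IsIsometry.lintegral_innerDual_mvfderiv_comp` — the Dirichlet energies of `f ∘ Φ` and `f` agree.

Everything is proved; no definitions, no named facts (D-0026).

## References

* B. O'Neill, *Semi-Riemannian geometry*, Academic Press 1983, Ch. 3, Def. 3.4 (p. 58),
  Prop. 3.59, pp. 90–91. [`ONeill1983`]
-/

noncomputable section

open Bundle Set Function Filter Topology MeasureTheory Manifold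
open scoped Manifold ContDiff

namespace Literature.Geometry.Riemannian

open Literature.Geometry.Lorentzian
open Literature.Geometry.Lorentzian.PseudoRiemannianMetric

variable {E : Type*} [NormedAddCommGroup E] [NormedSpace ℝ E] {H : Type*} [TopologicalSpace H]
  {I : ModelWithCorners ℝ E H} {M : Type*} [TopologicalSpace M] [ChartedSpace H M]
  [IsManifold I ∞ M]
  {E' : Type*} [NormedAddCommGroup E'] [NormedSpace ℝ E'] {H' : Type*} [TopologicalSpace H']
  {I' : ModelWithCorners ℝ E' H'} {N : Type*} [TopologicalSpace N] [ChartedSpace H' N]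
  [IsManifold I' ∞ N]
  [FiniteDimensional ℝ E] [FiniteDimensional ℝ E']
  (Φ : Diffeomorph I' I N M ∞)

omit [IsManifold I ∞ M] [IsManifold I' ∞ N] [FiniteDimensional ℝ E] [FiniteDimensional ℝ E'] in
/-- A `C^∞` map is `C^{∞ + 1}` (`∞ + 1 = ∞` in `ℕ∞ω`). [folklore] -/
theorem contMDiff_infty_add_one {f : N → M} (hf : ContMDiff I' I ∞ f) : ContMDiff I' I (∞ + 1) f :=
  hf.of_le (le_of_eq (by rfl))

/-! ### The transported metric -/

/-- **Transport of a Riemannian metric along a diffeomorphism.** For a `C^∞` diffeomorphism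
`Φ : N → M` between manifolds over models of the same dimension and a smooth Riemannian metric `h`
on `M` (a Mathlib `ContMDiffRiemannianMetric`), there is a smooth Riemannian metric `hN` on `N`
making `Φ` an isometry `(N, hN) → (M, h)`: the pullback `Φ^* h`
(`PseudoRiemannianMetric.comap`, smooth by `contMDiff_pullbackBilin_holds`, positive definite
since `dΦ` is injective). O'Neill 1983, Ch. 3, pp. 58 and 90–91. [cite: ONeill1983, Ch. 3, pp. 90–91] -/
theorem exists_contMDiffRiemannianMetric_isIsometry (hdim : Module.finrank ℝ E' = Module.finrank ℝ E)
    (h : ContMDiffRiemannianMetric I ∞ E (TangentSpace I : M → Type _)) :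
    ∃ hN : ContMDiffRiemannianMetric I' ∞ E' (TangentSpace I' : N → Type _),
      IsIsometry (ofRiemannian hN) (ofRiemannian h) Φ := by
  set g := ofRiemannian h with hgdef
  have hΦ1 : ContMDiff I' I (∞ + 1) Φ := contMDiff_infty_add_one Φ.contMDiff
  have hinj : ∀ y, Function.Injective (mfderiv I' I Φ y) := fun y ↦
    (Φ.mfderivToContinuousLinearEquiv (by simp) y).injective
  set gN := g.comap contMDiff_pullbackBilin_holds Φ hΦ1 hinj hdim with hgN
  have hgNr : gN.IsRiemannian := by
    intro y v hv
    show 0 < (g.comap contMDiff_pullbackBilin_holds Φ hΦ1 hinj hdim).val y v v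
    rw [val_comap, pullbackBilin_apply]
    refine isRiemannian_ofRiemannian h _ _ fun h0 ↦ hv (hinj y ?_)
    rw [map_zero]; exact h0
  refine ⟨gN.toContMDiffRiemannianMetric hgNr, fun y ↦ ?_⟩
  have heq : ofRiemannian (gN.toContMDiffRiemannianMetric hgNr) = gN := by ext; rfl
  rw [heq]
  rfl

variable {Φ}
variable {hN : ContMDiffRiemannianMetric I' ∞ E' (TangentSpace I' : N → Type _)}
  {h : ContMDiffRiemannianMetric I ∞ E (TangentSpace I : M → Type _)}

/-- An isometry identifies the source metric with the pullback of the target metric.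
[cite: ONeill1983, Ch. 3, Def. 3.4 (p. 58)] -/
theorem _root_.Literature.Geometry.Lorentzian.PseudoRiemannianMetric.IsIsometry.eq_comap (hΦ : IsIsometry (ofRiemannian hN) (ofRiemannian h) Φ)
    (hdim : Module.finrank ℝ E' = Module.finrank ℝ E) :
    ofRiemannian hN = (ofRiemannian h).comap contMDiff_pullbackBilin_holds Φ
      (contMDiff_infty_add_one Φ.contMDiff)
      (fun y ↦ (Φ.mfderivToContinuousLinearEquiv (by simp) y).injective) hdim := by
  ext y v w
  rw [val_comap, ← hΦ y]

/-! ### The inverse metric on pulled-back covectors -/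

/-- **The inverse metrics correspond on pulled-back covectors**: for an isometry `Φ`, `u ∈ N` and
covectors `α, β` at `Φ u`, `hN⁻¹_u(α ∘ dΦ_u, β ∘ dΦ_u) = h⁻¹_{Φ u}(α, β)` (because
`♯_{hN}(β ∘ dΦ) = dΦ⁻¹ (♯_h β)`). O'Neill 1983, Ch. 3, p. 60 with Def. 3.4.
[cite: ONeill1983, Ch. 3, Def. 3.4 (p. 58)] -/
theorem _root_.Literature.Geometry.Lorentzian.PseudoRiemannianMetric.IsIsometry.innerDual_comp_mfderiv (hΦ : IsIsometry (ofRiemannian hN) (ofRiemannian h) Φ)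
    (u : N) (α β : Module.Dual ℝ (TangentSpace I (Φ u))) :
    (ofRiemannian hN).innerDual u (α.comp (mfderiv I' I Φ u).toLinearMap)
        (β.comp (mfderiv I' I Φ u).toLinearMap) = (ofRiemannian h).innerDual (Φ u) α β := by
  set gN := ofRiemannian hN with hgN
  set gM := ofRiemannian h with hgM
  set A := Φ.mfderivToContinuousLinearEquiv (by simp) u with hA
  have hAco : ∀ v, A v = mfderiv I' I Φ u v := fun v ↦ rfl
  set s := gM.sharp (Φ u) β with hs
  -- `♯_{gN}(β ∘ A) = A⁻¹ s`
  have hflat : gN.flat u (A.symm s) = β.comp (mfderiv I' I Φ u).toLinearMap := by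
    refine LinearMap.ext fun w ↦ ?_
    rw [flat_apply, LinearMap.comp_apply]
    have h1 := hΦ.val_mfderiv_mfderiv u (A.symm s) w
    rw [← hAco, A.apply_symm_apply] at h1
    rw [← h1, hs, val_sharp_apply]
    rfl
  have hsharp : gN.sharp u (β.comp (mfderiv I' I Φ u).toLinearMap) = A.symm s := by
    rw [← hflat, sharp_flat]
  show (α.comp (mfderiv I' I Φ u).toLinearMap) (gN.sharp u (β.comp (mfderiv I' I Φ u).toLinearMap)) =
    α (gM.sharp (Φ u) β)
  rw [hsharp, LinearMap.comp_apply]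
  show α (mfderiv I' I Φ u (A.symm s)) = α s
  rw [← hAco, A.apply_symm_apply]

/-- **`|d(f ∘ Φ)|²` transports**: for an isometry `Φ` and `f` differentiable at `Φ u`,
`hN⁻¹(d(f∘Φ)_u, d(f∘Φ)_u) = h⁻¹(df_{Φ u}, df_{Φ u})` (chain rule and
`innerDual_comp_mfderiv`); more generally for two functions. [cite: ONeill1983, Ch. 3, pp. 90–91] -/
theorem _root_.Literature.Geometry.Lorentzian.PseudoRiemannianMetric.IsIsometry.innerDual_mvfderiv_comp (hΦ : IsIsometry (ofRiemannian hN) (ofRiemannian h) Φ)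
    {f f' : M → ℝ} {u : N} (hf : MDiffAt f (Φ u)) (hf' : MDiffAt f' (Φ u)) :
    (ofRiemannian hN).innerDual u (mvfderiv I' (f ∘ Φ) u).toLinearMap
        (mvfderiv I' (f' ∘ Φ) u).toLinearMap =
      (ofRiemannian h).innerDual (Φ u) (mvfderiv I f (Φ u)).toLinearMap
        (mvfderiv I f' (Φ u)).toLinearMap := by
  have hΦu : MDifferentiableAt I' I Φ u := (Φ.contMDiff u).mdifferentiableAt (by simp)
  have h1 : (mvfderiv I' (f ∘ Φ) u).toLinearMap =
      (mvfderiv I f (Φ u)).toLinearMap.comp (mfderiv I' I Φ u).toLinearMap := by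
    refine LinearMap.ext fun v ↦ ?_
    exact mvfderiv_comp_apply hf hΦu v
  have h2 : (mvfderiv I' (f' ∘ Φ) u).toLinearMap =
      (mvfderiv I f' (Φ u)).toLinearMap.comp (mfderiv I' I Φ u).toLinearMap := by
    refine LinearMap.ext fun v ↦ ?_
    exact mvfderiv_comp_apply hf' hΦu v
  rw [h1, h2]
  exact hΦ.innerDual_comp_mfderiv u _ _

/-! ### The Sobolev inequality transports -/

section Sobolev

variable [T3Space M] [MeasurableSpace M] [BorelSpace M] [T3Space N] [MeasurableSpace N]
  [BorelSpace N]

/-- **The Riemannian measures correspond under an isometry** of Mathlib Riemannian metrics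
(`IsIsometry.measurePreserving_riemannianMeasure` read through `ofRiemannian`). [cite: ONeill1983, Ch. 3, pp. 90–91] -/
theorem _root_.Literature.Geometry.Lorentzian.PseudoRiemannianMetric.IsIsometry.measurePreserving (hΦ : IsIsometry (ofRiemannian hN) (ofRiemannian h) Φ) :
    MeasurePreserving Φ (riemannianMeasure hN) (riemannianMeasure h) :=
  hΦ.measurePreserving_riemannianMeasure (by simp) (isRiemannian_ofRiemannian hN)
    (isRiemannian_ofRiemannian h)

/-- **The Sobolev inequality is an isometry invariant**: if `Φ : (N, hN) → (M, h)` is an isometry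
and `(M, h)` satisfies `(S_p)` with constant `μ` (`HasSobolevInequality h p μ`), so does `(N, hN)`:
test against `u ∘ Φ⁻¹ ∈ C_c^∞(M)` and transport both integrals along the measure preserving `Φ`
(`|d(u ∘ Φ⁻¹)|²_h ∘ Φ = |du|²_{hN}`). [cite: ONeill1983, Ch. 3, pp. 90–91] -/
theorem _root_.Literature.Geometry.Lorentzian.PseudoRiemannianMetric.IsIsometry.hasSobolevInequality (hΦ : IsIsometry (ofRiemannian hN) (ofRiemannian h) Φ)
    {p μ : ℝ} (hS : HasSobolevInequality h p μ) : HasSobolevInequality hN p μ := by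
  intro u hu huc
  set ũ : M → ℝ := u ∘ Φ.symm with hũdef
  have hũ : ContMDiff I 𝓘(ℝ, ℝ) ∞ ũ := hu.comp Φ.symm.contMDiff
  have hũc : HasCompactSupport ũ := huc.comp_homeomorph Φ.symm.toHomeomorph
  have hSũ := hS ũ hũ hũc
  have hmp := hΦ.measurePreserving
  have hũΦ : ∀ y, ũ (Φ y) = u y := fun y ↦ by simp [hũdef]
  -- the `L^q` side
  have hL : ∫⁻ x, ENNReal.ofReal (|ũ x| ^ (2 * p / (p - 2))) ∂riemannianMeasure h =
      ∫⁻ y, ENNReal.ofReal (|u y| ^ (2 * p / (p - 2))) ∂riemannianMeasure hN := by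
    rw [← hmp.lintegral_comp_emb Φ.toHomeomorph.measurableEmbedding]
    simp only [hũΦ]
  -- the energy side
  have hR : ∫⁻ x, ENNReal.ofReal ((ofRiemannian h).innerDual x (mvfderiv I ũ x).toLinearMap
      (mvfderiv I ũ x).toLinearMap) ∂riemannianMeasure h =
      ∫⁻ y, ENNReal.ofReal ((ofRiemannian hN).innerDual y (mvfderiv I' u y).toLinearMap
        (mvfderiv I' u y).toLinearMap) ∂riemannianMeasure hN := by
    rw [← hmp.lintegral_comp_emb Φ.toHomeomorph.measurableEmbedding]
    refine lintegral_congr fun y ↦ ?_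
    have hd : MDiffAt ũ (Φ y) := (hũ (Φ y)).mdifferentiableAt (by simp)
    rw [← hΦ.innerDual_mvfderiv_comp hd hd]
    have : ũ ∘ Φ = u := funext hũΦ
    rw [this]
  rw [hL, hR] at hSũ
  exact hSũ

end Sobolev

/-! ### Harmonic functions and Dirichlet energy transport -/

section Harmonic

/-- **The Laplace–Beltrami operator is natural under isometries**: for an isometry
`Φ : (N, hN) → (M, h)` and `f` of class `C²` at `Φ u`, `Δ_{hN}(f ∘ Φ)(u) = Δ_h f (Φ u)`
(`dalembertian_comap` for the pullback metric, to which `hN` is equal by `IsIsometry.eq_comap`).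
O'Neill 1983, Ch. 3, Prop. 3.59 and pp. 90–91. [cite: ONeill1983, Ch. 3, Prop. 3.59] -/
theorem _root_.Literature.Geometry.Lorentzian.PseudoRiemannianMetric.IsIsometry.dalembertian_comp
    (hΦ : IsIsometry (ofRiemannian hN) (ofRiemannian h) Φ)
    (hdim : Module.finrank ℝ E' = Module.finrank ℝ E) [(ofRiemannian hN).HasLeviCivita]
    [(ofRiemannian h).HasLeviCivita] {u : N} {f : M → ℝ} (hf : CMDiffAt 2 f (Φ u)) :
    (ofRiemannian hN).dalembertian (f ∘ Φ) u = (ofRiemannian h).dalembertian f (Φ u) := by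
  haveI : CompleteSpace E := FiniteDimensional.complete ℝ E
  haveI : CompleteSpace E' := FiniteDimensional.complete ℝ E'
  have key : ∀ (g' : PseudoRiemannianMetric I' ∞ E' (TangentSpace I' : N → Type _))
      [g'.HasLeviCivita], g' = (ofRiemannian h).comap contMDiff_pullbackBilin_holds Φ
        (contMDiff_infty_add_one Φ.contMDiff)
        (fun y ↦ (Φ.mfderivToContinuousLinearEquiv (by simp) y).injective) hdim →
      g'.dalembertian (f ∘ Φ) u = (ofRiemannian h).dalembertian f (Φ u) := by
    intro g' _ hg'
    subst hg'
    exact dalembertian_comap (ofRiemannian h) contMDiff_pullbackBilin_holds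
      (contMDiff_infty_add_one Φ.contMDiff)
      (fun y ↦ (Φ.mfderivToContinuousLinearEquiv (by simp) y).injective) hdim hf
  exact key _ (hΦ.eq_comap hdim)

variable [T3Space M] [MeasurableSpace M] [BorelSpace M] [T3Space N] [MeasurableSpace N]
  [BorelSpace N]

/-- **The Dirichlet energy is an isometry invariant**: for an isometry `Φ : (N, hN) → (M, h)` and
`f : M → ℝ` differentiable, `∫⁻_N |d(f ∘ Φ)|²_{hN} dV_{hN} = ∫⁻_M |df|²_h dV_h`
(`innerDual_mvfderiv_comp` and the correspondence of the Riemannian measures).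
[cite: ONeill1983, Ch. 3, pp. 90–91] -/
theorem _root_.Literature.Geometry.Lorentzian.PseudoRiemannianMetric.IsIsometry.lintegral_innerDual_mvfderiv_comp
    (hΦ : IsIsometry (ofRiemannian hN) (ofRiemannian h) Φ) {f : M → ℝ} (hf : ∀ x, MDiffAt f x) :
    ∫⁻ y, ENNReal.ofReal ((ofRiemannian hN).innerDual y (mvfderiv I' (f ∘ Φ) y).toLinearMap
        (mvfderiv I' (f ∘ Φ) y).toLinearMap) ∂riemannianMeasure hN =
      ∫⁻ x, ENNReal.ofReal ((ofRiemannian h).innerDual x (mvfderiv I f x).toLinearMap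
        (mvfderiv I f x).toLinearMap) ∂riemannianMeasure h := by
  rw [← hΦ.measurePreserving.lintegral_comp_emb Φ.toHomeomorph.measurableEmbedding]
  refine lintegral_congr fun y ↦ ?_
  rw [hΦ.innerDual_mvfderiv_comp (hf _) (hf _)]

/-- **Almost-everywhere statements transport**: `P ∘ Φ` holds `dV_{hN}`-a.e. on `N` iff `P`
holds `dV_h`-a.e. on `M`. [cite: ONeill1983, Ch. 3, pp. 90–91] -/
theorem _root_.Literature.Geometry.Lorentzian.PseudoRiemannianMetric.IsIsometry.ae_comp_iff
    (hΦ : IsIsometry (ofRiemannian hN) (ofRiemannian h) Φ) {P : M → Prop} :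
    (∀ᵐ y ∂riemannianMeasure hN, P (Φ y)) ↔ ∀ᵐ x ∂riemannianMeasure h, P x := by
  rw [← hΦ.measurePreserving.map_eq]
  exact (MeasurableEmbedding.ae_map_iff (f := Φ) Φ.toHomeomorph.measurableEmbedding).symm

end Harmonic

end Literature.Geometry.Riemannian

end
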